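import Literature.Topology.FourManifolds.NonSeparatingSpheres
import Literature.Topology.FourManifolds.DehnSurgeryTubularNbhdProofs
import HarnessLib

/-!
# Budney–Gabai Thm. 3.13: at the transversal crossing with `S¹ × {p₀}` the sphere is a graph
# over the `Sⁿ` factor (infinitesimally)

Fact seat of `Literature.Topology.FourManifolds.BudneyGabai2019_thm_3_13` (R. Budney, D. Gabai,
*Knotted 3-balls in `S⁴`*, arXiv:1912.09029, Thm. 3.13).  Third sentence of the printed proof
(p. 22): *"If we drill a neighbourhood of `S¹ × {*}` out of `S¹ × Sⁿ` we have constructed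
`S¹ × Bⁿ`, and our non-separating sphere is converted to a reducing ball."*  For the sphere to meet
the tube `S¹ × D` around the (standardised) dual circle `S¹ × {p₀}` in a single disc, one uses that
at the unique crossing point the sphere is transverse to the circle, i.e. is locally a graph over
the `Sⁿ` factor.  This file proves the infinitesimal statement
(`BudneyGabai2019_thm_3_13.injective_mfderiv_snd_comp_of_transverse`): if a smooth embedding
`e : Sⁿ → S¹ × Sⁿ` is crossed at `e x₀` by an immersed arc `γ` with `γ'(0) ∉ de_{x₀}(T Sⁿ)` which
near `0` runs inside a fibre circle `S¹ × {p₀}`, then `d(pr₂ ∘ e)_{x₀}` is injective (hence an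
isomorphism `T_{x₀} Sⁿ ≅ T_{p₀} Sⁿ`): the tangent line of the arc is the horizontal line
`T(S¹ × {p₀})`, a complement of `de(T Sⁿ)`, so `de(T Sⁿ)` meets the kernel of `d pr₂` trivially.

Everything here is proved; no definition and no named fact is introduced.

## References

* R. Budney, D. Gabai, *Knotted 3-balls in `S⁴`*, arXiv:1912.09029 (v2), §3, proof of Thm. 3.13
  (p. 22). [BudneyGabai2019]
* M. W. Hirsch, *Differential Topology*, GTM 33 (1976), Ch. 3 §2 (transversality).
  [HirschDT1976]
-/

noncomputable section

open scoped Manifold ContDiff Topology Real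
open Set Function Metric Module Filter

namespace Literature.Topology.FourManifolds

namespace BudneyGabai2019_thm_3_13

variable {n : ℕ}

/-- A vector of `ℝ¹ = EuclideanSpace ℝ (Fin 1)` is a multiple of any nonzero vector. [folklore] -/
theorem exists_smul_eq_of_ne_zero_fin_one {v w : EuclideanSpace ℝ (Fin 1)} (hv : v ≠ 0) :
    ∃ c : ℝ, w = c • v := by
  have hv0 : v 0 ≠ 0 := by
    intro h0
    apply hv
    ext i
    rw [Subsingleton.elim i 0, h0]
    rfl
  refine ⟨w 0 / v 0, ?_⟩
  ext i
  rw [Subsingleton.elim i 0, PiLp.smul_apply, smul_eq_mul, div_mul_cancel₀ _ hv0]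

/-- **Transversal crossing with a fibre circle ⇒ the sphere is infinitesimally a graph over `Sⁿ`.**
Let `e : Sⁿ → S¹ × Sⁿ` be a smooth embedding and `γ : ℝ → S¹ × Sⁿ` a `C^∞` arc (through
`γ 0 = e x₀`, although only the tangent data enter) with `dγ₀` injective,
`dγ₀(1) ∉ de_{x₀}(T_{x₀} Sⁿ)`, and `(γ t)₂ = p₀` for `t` near `0` (the arc runs in the fibre circle
`S¹ × {p₀}`).  Then the differential at `x₀` of `pr₂ ∘ e : Sⁿ → Sⁿ` is injective.
[cite: HirschDT1976, Ch. 3 §2] -/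
theorem injective_mfderiv_snd_comp_of_transverse
    {e : Metric.sphere (0 : EuclideanSpace ℝ (Fin (n + 1))) 1 →
      Circle × Metric.sphere (0 : EuclideanSpace ℝ (Fin (n + 1))) 1}
    (he : Manifold.IsSmoothEmbedding (𝓡 n) ((𝓡 1).prod (𝓡 n)) ∞ e)
    {x₀ : Metric.sphere (0 : EuclideanSpace ℝ (Fin (n + 1))) 1}
    {p₀ : Metric.sphere (0 : EuclideanSpace ℝ (Fin (n + 1))) 1}
    {γ : ℝ → Circle × Metric.sphere (0 : EuclideanSpace ℝ (Fin (n + 1))) 1}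
    (hγs : ContMDiff 𝓘(ℝ, ℝ) ((𝓡 1).prod (𝓡 n)) ∞ γ)
    (hγimm : Injective (mfderiv 𝓘(ℝ, ℝ) ((𝓡 1).prod (𝓡 n)) γ 0))
    (hγtr : (mfderiv 𝓘(ℝ, ℝ) ((𝓡 1).prod (𝓡 n)) γ 0 (1 : ℝ) :
        EuclideanSpace ℝ (Fin 1) × EuclideanSpace ℝ (Fin n)) ∉
      (mfderiv (𝓡 n) ((𝓡 1).prod (𝓡 n)) e x₀).range)
    (hflat : ∀ᶠ t in 𝓝 (0 : ℝ), (γ t).2 = p₀) :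
    Injective (mfderiv (𝓡 n) (𝓡 n)
      (fun x ↦ (e x).2 : Metric.sphere (0 : EuclideanSpace ℝ (Fin (n + 1))) 1 →
        Metric.sphere (0 : EuclideanSpace ℝ (Fin (n + 1))) 1) x₀) := by
  set v : EuclideanSpace ℝ (Fin 1) × EuclideanSpace ℝ (Fin n) :=
    mfderiv 𝓘(ℝ, ℝ) ((𝓡 1).prod (𝓡 n)) γ 0 (1 : ℝ) with hv
  -- `v ≠ 0` (immersion)
  have hv0 : v ≠ 0 := by
    intro h0
    have h1 := (map_eq_zero_iff (mfderiv 𝓘(ℝ, ℝ) ((𝓡 1).prod (𝓡 n)) γ 0) hγimm).1 h0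
    have h2 : (1 : ℝ) = 0 := h1
    exact one_ne_zero h2
  -- `v` is horizontal: its `Sⁿ`-component vanishes (the arc runs in `S¹ × {p₀}` near `0`)
  have hv2 : v.2 = 0 := by
    have hsnd : mfderiv 𝓘(ℝ, ℝ) (𝓡 n) (fun t ↦ (γ t).2) 0 = 0 := by
      have hev : (fun t ↦ (γ t).2) =ᶠ[𝓝 (0 : ℝ)] fun _ ↦ p₀ := hflat
      rw [hev.mfderiv_eq]
      exact mfderiv_const
    have hchain : mfderiv 𝓘(ℝ, ℝ) (𝓡 n) (fun t ↦ (γ t).2) 0 =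
        (mfderiv ((𝓡 1).prod (𝓡 n)) (𝓡 n)
          (fun q : Circle × Metric.sphere (0 : EuclideanSpace ℝ (Fin (n + 1))) 1 ↦ q.2) (γ 0)).comp
          (mfderiv 𝓘(ℝ, ℝ) ((𝓡 1).prod (𝓡 n)) γ 0) :=
      mfderiv_comp 0 mdifferentiableAt_snd ((hγs 0).mdifferentiableAt (by simp))
    have e2 : mfderiv ((𝓡 1).prod (𝓡 n)) (𝓡 n)
        (fun q : Circle × Metric.sphere (0 : EuclideanSpace ℝ (Fin (n + 1))) 1 ↦ q.2) (γ 0) =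
        ContinuousLinearMap.snd ℝ (TangentSpace (𝓡 1) (γ 0).1) (TangentSpace (𝓡 n) (γ 0).2) :=
      mfderiv_snd
    have h1 := congrArg (fun T : TangentSpace 𝓘(ℝ, ℝ) (0 : ℝ) →L[ℝ] TangentSpace (𝓡 n) (γ 0).2 ↦
      T (1 : ℝ)) hchain
    rw [hsnd, e2] at h1
    have h2 : (0 : EuclideanSpace ℝ (Fin n)) = v.2 := h1
    exact h2.symm
  -- the differential of `pr₂ ∘ e`
  set B := mfderiv (𝓡 n) ((𝓡 1).prod (𝓡 n)) e x₀ with hB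
  have hBinj : Injective B := mfderiv_injective_of_isImmersion he.isImmersion (by simp) x₀
  have hchainE : mfderiv (𝓡 n) (𝓡 n)
      (fun x ↦ (e x).2 : Metric.sphere (0 : EuclideanSpace ℝ (Fin (n + 1))) 1 →
        Metric.sphere (0 : EuclideanSpace ℝ (Fin (n + 1))) 1) x₀ =
      (mfderiv ((𝓡 1).prod (𝓡 n)) (𝓡 n)
          (fun q : Circle × Metric.sphere (0 : EuclideanSpace ℝ (Fin (n + 1))) 1 ↦ q.2) (e x₀)).comp B :=
    mfderiv_comp x₀ mdifferentiableAt_snd (he.contMDiff.mdifferentiableAt (by simp))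
  have e3 : mfderiv ((𝓡 1).prod (𝓡 n)) (𝓡 n)
      (fun q : Circle × Metric.sphere (0 : EuclideanSpace ℝ (Fin (n + 1))) 1 ↦ q.2) (e x₀) =
      ContinuousLinearMap.snd ℝ (TangentSpace (𝓡 1) (e x₀).1) (TangentSpace (𝓡 n) (e x₀).2) :=
    mfderiv_snd
  intro ξ ζ hξζ
  -- reduce to the kernel
  have hker : ∀ η : TangentSpace (𝓡 n) x₀,
      mfderiv (𝓡 n) (𝓡 n) (fun x ↦ (e x).2 : Metric.sphere (0 : EuclideanSpace ℝ (Fin (n + 1))) 1 →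
        Metric.sphere (0 : EuclideanSpace ℝ (Fin (n + 1))) 1) x₀ η = 0 → η = 0 := by
    intro η hη
    rw [hchainE, e3] at hη
    have hη2 : (B η : EuclideanSpace ℝ (Fin 1) × EuclideanSpace ℝ (Fin n)).2 = 0 := hη
    -- `B η` is horizontal, hence a multiple of `v`
    obtain ⟨c, hc⟩ := exists_smul_eq_of_ne_zero_fin_one (w := (B η : EuclideanSpace ℝ (Fin 1) ×
      EuclideanSpace ℝ (Fin n)).1) (v := v.1) (by
        intro h0
        apply hv0
        exact Prod.ext h0 hv2)
    have hBη : (B η : EuclideanSpace ℝ (Fin 1) × EuclideanSpace ℝ (Fin n)) = c • v := by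
      refine Prod.ext ?_ ?_
      · rw [Prod.smul_fst]
        exact hc
      · rw [Prod.smul_snd, hv2, smul_zero]
        exact hη2
    by_cases hc0 : c = 0
    · rw [hc0, zero_smul] at hBη
      have : B η = B 0 := by rw [map_zero]; exact hBη
      exact hBinj this
    · exfalso
      apply hγtr
      have hmem : (B η : EuclideanSpace ℝ (Fin 1) × EuclideanSpace ℝ (Fin n)) ∈ B.range := ⟨η, rfl⟩
      rw [hBη] at hmem
      exact (B.range.smul_mem_iff hc0).1 hmem
  have hdiff : mfderiv (𝓡 n) (𝓡 n)
      (fun x ↦ (e x).2 : Metric.sphere (0 : EuclideanSpace ℝ (Fin (n + 1))) 1 →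
        Metric.sphere (0 : EuclideanSpace ℝ (Fin (n + 1))) 1) x₀ (ξ - ζ) = 0 := by
    rw [map_sub, sub_eq_zero]
    exact hξζ
  exact sub_eq_zero.1 (hker _ hdiff)

end BudneyGabai2019_thm_3_13

end Literature.Topology.FourManifolds

end
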